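import Summits.Ventures.PercRepro2.CaseOneStarCertT1
import Summits.Ventures.PercRepro2.CaseOneGadgetUWA1BBlockI0
import Summits.Ventures.PercRepro2.CaseOneGadgetUWA1BBlockI1
import Summits.Ventures.PercRepro2.CaseOneGadgetUWA1BBlockI2
import Summits.Ventures.PercRepro2.CaseOneGadgetUWA1BBlockI3
import Summits.Ventures.PercRepro2.CaseOneGadgetUWA1BBlockI4
import Summits.Ventures.PercRepro2.CaseOneGadgetUWA1BBlockI5
import Summits.Ventures.PercRepro2.CaseOneGadgetUWA1BBlockI6
import Summits.Ventures.PercRepro2.CaseOneGadgetUWA1BBlockI7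
import Summits.Ventures.PercRepro2.CaseOneGadgetUWA1BBlockI8
import Summits.Ventures.PercRepro2.CaseOneGadgetUWA1BBlockI9
import Summits.Ventures.PercRepro2.CaseOneGadgetUWA1BBlockI10
import Summits.Ventures.PercRepro2.CaseOneGadgetUWA1BBlockI11
import Summits.Ventures.PercRepro2.CaseOneGadgetUWA1BBlockI12
import Summits.Ventures.PercRepro2.CaseOneGadgetUWA1BBlockI13
import Summits.Ventures.PercRepro2.CaseOneGadgetUWA1BBlockI14
import Summits.Ventures.PercRepro2.CaseOneStarFactsB

/-!
# The gadget `u ~ {w, a₁, b}`, `w ~ {u, a₂, o}` (uwa1b): the cell certificates of `iAB5` (part 32b)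
(blind cell PercRepro2, p1 g34; the fourth gadget anchor of the six-form calculus — all six forms of the uwa1b gadget
as plain SFacts-cone certificate chains, generated by mining/p1/g34/uwa1b/genu.py = p1 g33's gent_uwa1.py / g25's
geno.py re-targeted; P1-G33 §6–§6″, P1-G34)

Each `eBABI ijk kl` is a nonnegative combination of `(pairwise atom) × (cell)` and cubic cell monomials — or, for the degree-4 ones, `M × eBABI ijk kl` (`M = Σ cᵢ` the total cell mass) is a nonnegative combination of `(atom) × (cell) × (cell)` and quartic cell monomials, then `SFacts.nonneg_of_sum_mul` (`CaseOneStarCertT1`) — exact LP certificates (kit j319447, every certificate re-verified exactly; data/p1/g33/gcerts_i_uwa1b.json, form `i`), here as exact `linear_combination`s over `SFacts` (the rational coefficients cleared by their common denominator). -/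

namespace Summit.Ventures.PercRepro2

namespace CaseOne

section CertABI32b
variable {R : Type*} [Field R] [LinearOrder R] [IsStrictOrderedRing R]

set_option maxHeartbeats 0 in
/-- `eBABI22313 ≥ 0`: the combination is identically zero (`ring`). -/
lemma eBABI22313_nonneg (m : SCells R) (_hf : SFactsB m) : 0 ≤ eBABI22313 m := by
  have h : eBABI22313 m = 0 := by
    unfold eBABI22313 cBABI00113 cBABI00213 cBABI01013 cBABI01113 cBABI01213 cBABI01313 cBABI02013 cBABI02113 cBABI02213 cBABI02313 cBABI10013 cBABI10113 cBABI10213 cBABI10313 cBABI11013 cBABI11113 cBABI11213 cBABI11313 cBABI12013 cBABI12113 cBABI12213 cBABI12313 cBABI20013 cBABI20113 cBABI20213 cBABI20313 cBABI21013 cBABI21113 cBABI21213 cBABI21313 cBABI22013 cBABI22113 cBABI22213 cBABI22313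
    ring
  linarith [h]

set_option maxHeartbeats 0 in
/-- `eBABI22320 ≥ 0`: the combination is identically zero (`ring`). -/
lemma eBABI22320_nonneg (m : SCells R) (_hf : SFactsB m) : 0 ≤ eBABI22320 m := by
  have h : eBABI22320 m = 0 := by
    unfold eBABI22320 cBABI00120 cBABI00220 cBABI01020 cBABI01120 cBABI01220 cBABI01320 cBABI02020 cBABI02120 cBABI02220 cBABI02320 cBABI10120 cBABI10220 cBABI11020 cBABI11120 cBABI11220 cBABI11320 cBABI12020 cBABI12120 cBABI12220 cBABI12320 cBABI20120 cBABI20220 cBABI21020 cBABI21120 cBABI21220 cBABI21320 cBABI22020 cBABI22120 cBABI22220 cBABI22320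
    ring
  linarith [h]

end CertABI32b

end CaseOne

end Summit.Ventures.PercRepro2
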